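import Summits.AtomisticToContinuum.HydrodynamicLimit.Theses.AntiMazurCoboundaries
import Literature.MathematicalPhysics.KineticTheory.HardSphereEulerProofs

/-!
# Negative knowledge for `KineticWindowGronwall` (stmt-AtomisticToContinuum-9282), III: the antecedent's activity is a dummy

From the standing disprover's `Cruxes/KineticWindowGronwall/Disproof.lean` §7 (cycle 2,
refuter-cdisprove-stmt-AtomisticToContinuum-9282-g2-0). The crux is `KineticFluxLdDecay → RelEntropyVanishing`.
Its antecedent quantifies `∀ a > 0` over the activity of the CONSTANT-profile local Gibbs law, but at fixed particle
number a constant activity cancels from `canonicalDensity` (`localGibbsLaw_const_activity`), so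
`KineticFluxLdDecay ↔ KineticFluxLdDecayUnitActivity` (`kineticFluxLdDecay_iff_unitActivity`): the antecedent is a
statement about ONE state per reduced-density parameter `σ` (macroscopic density `1`), and every use of it at the local
density `ρ(t,x)` of an Euler solution is a re-embedding at parameter `σρ^{1/3}` (`hsDiameter_reembed`). Consequently the
crux may be attacked/proved with the antecedent at activity `1` (`crux_iff_unitActivity_imp`). Pure theorems; no
positive Theses conclusion.
-/

noncomputable section

namespace Summit.AtomisticToContinuum.HydrodynamicLimit.Theorems.KineticWindowGronwallNegative

open MeasureTheory Filter Set Topology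
open scoped ENNReal
open Literature.MathematicalPhysics.KineticTheory Literature.Analysis.FluidPDE
open Summit.AtomisticToContinuum.HydrodynamicLimit.Theses.AntiMazurCoboundaries

/-- A constant activity factors out of the local Gibbs profile. [folklore] -/
theorem localGibbsProfile_const_activity (a θ : ℝ) (u : V3) (y : T3 × V3) :
    localGibbsProfile (fun _ => a) (fun _ => u) (fun _ => θ) y =
      a * localGibbsProfile (fun _ => (1 : ℝ)) (fun _ => u) (fun _ => θ) y := by
  simp [localGibbsProfile]

/-- Tensor powers are multiplicative in a constant factor. [folklore] -/
theorem tensorPow_const_mul {n : ℕ} (a : ℝ) (f : T3 × V3 → ℝ) :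
    tensorPow n (fun y => a * f y) = fun z : Config n (Fin 3) T3 => a ^ n * tensorPow n f z := by
  funext z
  simp [tensorPow, Finset.prod_mul_distrib, Finset.prod_const]

/-- The canonical density does not see a non-zero constant factor in the one-particle profile (it cancels
against the partition function; if the partition function vanishes both sides are the junk `0`). [folklore] -/
theorem canonicalDensity_const_mul {n : ℕ} {a : ℝ} (ha : a ≠ 0) (ε : ℝ) (f : T3 × V3 → ℝ)
    (z : Config n (Fin 3) T3) :
    canonicalDensity (Torus.geometry (Fin 3)) ε n (fun y => a * f y) z =
      canonicalDensity (Torus.geometry (Fin 3)) ε n f z := by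
  set D := hardSphereDomain (Torus.geometry (Fin 3)) n ε with hD
  have hind : D.indicator (tensorPow n (fun y => a * f y)) =
      fun z => a ^ n * D.indicator (tensorPow n f) z := by
    funext w
    rw [tensorPow_const_mul]
    by_cases hw : w ∈ D <;> simp [hw]
  have hZ : canonicalPartition (Torus.geometry (Fin 3)) ε n (fun y => a * f y) =
      a ^ n * canonicalPartition (Torus.geometry (Fin 3)) ε n f := by
    simp only [canonicalPartition, ← hD, hind]
    exact integral_const_mul _ _
  have han : (a ^ n)⁻¹ * a ^ n = 1 := inv_mul_cancel₀ (pow_ne_zero n ha)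
  simp only [canonicalDensity, ← hD, hZ, hind]
  calc (a ^ n * canonicalPartition (Torus.geometry (Fin 3)) ε n f)⁻¹ * (a ^ n * D.indicator (tensorPow n f) z)
      = ((a ^ n)⁻¹ * a ^ n) * ((canonicalPartition (Torus.geometry (Fin 3)) ε n f)⁻¹ *
          D.indicator (tensorPow n f) z) := by rw [mul_inv]; ring
    _ = _ := by rw [han, one_mul]

/-- **The activity is decorative at fixed particle number**: for `a ≠ 0` the constant-profile local Gibbs law
(the global Gibbs law `G_N` of the antecedent) does not depend on `a`. (Same lemma as in the sibling disprover file
`Cruxes/BoltzmannGreenKubo/Disproof.lean` §1c, re-proved here to keep this file import-stable.) [folklore] -/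
theorem localGibbsLaw_const_activity {a : ℝ} (ha : a ≠ 0) (σ θ : ℝ) (u : V3) (N : ℕ)
    (Φ : HardSphereFlow (Torus.geometry (Fin 3)) (hsDiameter σ N) (N + 1)) :
    localGibbsLaw σ (fun _ => a) (fun _ => u) (fun _ => θ) N Φ =
      localGibbsLaw σ (fun _ => 1) (fun _ => u) (fun _ => θ) N Φ := by
  unfold localGibbsLaw
  have hprof : localGibbsProfile (fun _ => a) (fun _ => u) (fun _ => θ) =
      fun y => a * localGibbsProfile (fun _ => (1 : ℝ)) (fun _ => u) (fun _ => θ) y :=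
    funext (localGibbsProfile_const_activity a θ u)
  rw [hprof]
  congr 1
  funext z
  exact canonicalDensity_const_mul ha _ _ z

/-- `KineticFluxLdDecay` at the single activity `a = 1` (all else verbatim). -/
def KineticFluxLdDecayUnitActivity : Prop :=
  ∀ (θ : ℝ) (u₀ : V3), 0 < θ → ∃ σ₀ : ℝ, 0 < σ₀ ∧ ∀ σ : ℝ, 0 < σ → σ < σ₀ →
    (∀ (N : ℕ) (Φ : HardSphereFlow (Torus.geometry (Fin 3)) (hsDiameter σ N) (N + 1)),
      IsProbabilityMeasure (localGibbsLaw σ (fun _ => 1) (fun _ => u₀) (fun _ => θ) N Φ)) ∧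
    ∃ κ : ℝ, 0 < κ ∧ ∀ (φ : T3 → ℝ) (g : V3 → ℝ), Continuous φ → Continuous g → (∀ x, |φ x| ≤ 1) →
      (∀ v, |g v| ≤ κ) →
      (∀ (c₀ c₂ : ℝ) (b : V3), ∫ v, g v * (c₀ + inner ℝ b v + c₂ * ‖v‖ ^ 2) ∂(ProbabilityTheory.stdGaussian V3) = 0) →
      ∀ δ : ℝ, 0 < δ → ∃ τ : ℝ, 0 < τ ∧ ∃ N₀ : ℕ, ∀ N : ℕ, N₀ ≤ N →
        ∀ Φ : HardSphereFlow (Torus.geometry (Fin 3)) (hsDiameter σ N) (N + 1),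
          ∫⁻ z, ENNReal.ofReal (Real.exp ((τ * ((N + 1 : ℕ) : ℝ) ^ (-(1 / 3 : ℝ)))⁻¹ *
              ∫ s in (0 : ℝ)..(τ * ((N + 1 : ℕ) : ℝ) ^ (-(1 / 3 : ℝ))),
                ∑ i, φ (Φ.flow s z i).1 * g ((Real.sqrt θ)⁻¹ • ((Φ.flow s z i).2 - u₀))))
            ∂(localGibbsLaw σ (fun _ => 1) (fun _ => u₀) (fun _ => θ) N Φ) ≤
          ENNReal.ofReal (Real.exp (δ * (N + 1)))

/-- **The `∀ a` of the antecedent is vacuous repetition**: `KineticFluxLdDecay ↔ KineticFluxLdDecayUnitActivity`.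
Consequence (density-range bookkeeping, BN1 of the round-1 barrier notes): A is a statement about ONE state per `σ`
— `N + 1` spheres of diameter `σ(N+1)^{-1/3}` in the unit torus, uniform positions, Maxwellian velocities, i.e.
macroscopic density `1` — so every use of A at the local density `ρ(t,x)` of the Euler solution goes through
RE-EMBEDDING a block at reduced parameter `σ ρ^{1/3}` (`hsDiameter_reembed`), and the Gronwall along a solution with
`sup ρ = ρ_max` consumes A on the whole interval `σ' ∈ (0, σ ρ_max^{1/3}]`, available from A's `∀ σ' < σ₀` clause only
while `σ ρ_max^{1/3} < σ₀(A)`; B fixes its `σ₀` BEFORE the Euler solution is quantified, whose `ρ_max` is not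
bounded a priori (dense excursions: crux `ImplosionDichotomy.DenseExcursion`, stmt-12586, open). [folklore] -/
theorem kineticFluxLdDecay_iff_unitActivity : KineticFluxLdDecay ↔ KineticFluxLdDecayUnitActivity := by
  constructor
  · intro h θ u₀ hθ
    exact h 1 θ u₀ one_pos hθ
  · intro h a θ u₀ ha hθ
    obtain ⟨σ₀, hσ₀, H⟩ := h θ u₀ hθ
    refine ⟨σ₀, hσ₀, fun σ hσ hσ' => ?_⟩
    simp only [localGibbsLaw_const_activity ha.ne']
    exact H σ hσ hσ'

/-- **Re-embedding arithmetic** (block self-similarity at fixed reduced density): a block of side `R` of the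
`σ`-system at local macroscopic density `ρ` holds `N' + 1 = ρ R³ (N+1)` spheres of diameter `σ(N+1)^{-1/3}`; rescaled
to the unit torus their diameter is `σ(N+1)^{-1/3}/R = (σ ρ^{1/3}) (N'+1)^{-1/3}` — the `σ`-system at density `ρ` IS
the `σρ^{1/3}`-system at density `1`. [folklore] -/
theorem hsDiameter_reembed {σ ρ R : ℝ} (hρ : 0 < ρ) (hR : 0 < R) {N N' : ℕ}
    (h : ((N' + 1 : ℕ) : ℝ) = ρ * R ^ 3 * ((N + 1 : ℕ) : ℝ)) :
    hsDiameter σ N / R = hsDiameter (σ * ρ ^ (1 / 3 : ℝ)) N' := by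
  unfold hsDiameter
  have hM : (0 : ℝ) < ((N + 1 : ℕ) : ℝ) := by positivity
  rw [h, Real.mul_rpow (by positivity) hM.le, Real.mul_rpow hρ.le (by positivity)]
  have h1 : (R ^ 3 : ℝ) ^ (-(1 / 3 : ℝ)) = R⁻¹ := by
    rw [show (R ^ 3 : ℝ) = R ^ ((3 : ℕ) : ℝ) from (Real.rpow_natCast R 3).symm, ← Real.rpow_mul hR.le]
    norm_num
    exact Real.rpow_neg_one R
  have h2 : ρ ^ (1 / 3 : ℝ) * ρ ^ (-(1 / 3 : ℝ)) = 1 := by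
    rw [← Real.rpow_add hρ]; norm_num
  rw [h1]
  calc σ * ((N + 1 : ℕ) : ℝ) ^ (-(1 / 3 : ℝ)) / R
      = σ * (ρ ^ (1 / 3 : ℝ) * ρ ^ (-(1 / 3 : ℝ))) * R⁻¹ * ((N + 1 : ℕ) : ℝ) ^ (-(1 / 3 : ℝ)) := by
        rw [h2]; ring
    _ = σ * ρ ^ (1 / 3 : ℝ) * (ρ ^ (-(1 / 3 : ℝ)) * R⁻¹ * ((N + 1 : ℕ) : ℝ) ^ (-(1 / 3 : ℝ))) := by ring

/-- The crux may be proved with the antecedent taken at activity `1` only (§7). [folklore] -/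
theorem crux_iff_unitActivity_imp :
    KineticWindowGronwall ↔ (KineticFluxLdDecayUnitActivity → RelEntropyVanishing) := by
  rw [show KineticWindowGronwall = (KineticFluxLdDecay → RelEntropyVanishing) from rfl,
    kineticFluxLdDecay_iff_unitActivity]


end Summit.AtomisticToContinuum.HydrodynamicLimit.Theorems.KineticWindowGronwallNegative

end
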